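import Literature.NumberTheory.EllipticCurves.ModularCurve
import Literature.NumberTheory.EllipticCurves.ImaginaryPeriod
import Literature.NumberTheory.EllipticCurves.Tamagawa
import Literature.NumberTheory.EllipticCurves.GaloisAction
import Mathlib.NumberTheory.DirichletCharacter.Basic
import HarnessLib

/-!
# Kato's integral zeta elements read in NÉRON units at an ADDITIVE prime `p > 7` (Kim–Nakamura /
# Kosters–Pannekoek receptacle): the `N`-imprimitive Birch–Manin twisted values are `p`-integral against
# the Néron periods, for quadratic twists of conductor prime to `pN`, when `E[p]` is irreducible (named fact)

Topic `NumberTheory/EllipticCurves`. ONE named fact (`def … : Prop`, D-0014), a DERIVED READING of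
printed theorems, weaker than the derivation in every binder, and nothing else. Sibling in format and
in normalisation of `Kato2004.rankZero_padicValNat_sha_le_of_additive_potGood_of_imageContainsSL2`
(Kato 14.5 (3) + 14.16 (2) + Kim Lemma 3.10 read with `γ` and `ω` both on `E`, "the Manin constant of
`φ` cancels"); the difference — and the point — is that this reading carries NO Manin-constant binder
and NO modular-degree hypothesis. Consumer: `Summits/BirchSwinnertonDyer/BirchSwinnertonDyer/Theorems/
AdditiveKolyvaginRoadManinFrameResidueProperRUnitTwist.lean` (cell `pub/bsd-wall`, crux
`ManinFrameResidueProperR`, stmt-BirchSwinnertonDyer-20709: with ONE `p`-unit twisted value in the units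
of the newform at the optimal curve, the fact forces `p ∤ c₀` — the Euler-system lever of cell
`bsd-f2-manin`, crux-idea `kato-kp-unit-twist`, PROOF-es §A–§C, §F).

## The printed statements

* K. Kato, *`p`-adic Hodge theory and values of zeta functions of modular forms*, Astérisque 295 (2004)
  [Kato2004Asterisque]; held copy `paper:doi-10-24033-ast-639` (OCR). **(8.1.3)** (p. 180): for
  `m ≥ 1`, a normalised newform `f`, `ξ`, `S`, `r`, `r'`, `c`, `d` as in (8.1.2) (`1 ≤ r' ≤ k − 1`,
  `prime(cd) ∩ S = ∅`, `(cd, 6) = 1`, `(d, N) = 1`) and a finite place `λ` of `F = ℚ(a_n)`: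
  `_{c,d} z_m^{(p)}(f, r, r', ξ, S) ∈ H¹(ℤ[1/p, ζ_m], V_{O_λ}(f)(k − r))`, where (p. 181)
  "`V_{O_λ}(f)` is the `O_λ`-submodule of `V_{F_λ}(f)` generated by the image of `V_{k,ℤ_p}(Y₁(N))`"
  and "those [elements] with `ξ ∈ SL₂(ℤ)` can not take care of bad Euler factors, but will take care
  of delicate integrality". **Thm. 9.7** (p. 189): "the map `exp* : H¹(ℚ(ζ_m) ⊗ ℚ_p, V_{F_λ}(f)(k − r))
  → S(f) ⊗_F F_λ ⊗ ℚ(ζ_m)` sends the image of `_{c,d} z_m^{(p)}(f, r, r', ξ, S)` to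
  `_{c,d} δ_m(f, r, r', ξ, S)`". **Thm. 6.6 (1)** (p. 163): for a character `χ : (ℤ/m)^× → ℂ^×`,
  `Σ_{b ∈ (ℤ/m)^×} χ(b) per_f(σ_b(_{c,d} δ_m(f, r, r', ξ, S)))^± = T · L_S(f*, χ, r)·(2πi)^{k−r−1}·γ^±`
  with, in the case `ξ ∈ SL₂(ℤ)` (and `c ≡ d ≡ 1 mod N`), `T = (c² − c^u χ̄(c))(d² − d^v χ̄(d))` (BOTH characters barred, as printed — p. 163, second display; the reading `χ(c)` formerly written here was erratum F-UE-1 / docket DD-213, cf. `Kato2004.exists_member_sl2ZetaElement_neron_values_bar`),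
  `u, v ∈ ℤ` as in (4.2.4); `L_S` = the `L`-function with the Euler factors at the primes of `S`
  removed. Remark after **(12.8.1)** (p. 223): if (12.5.2) holds for one stable lattice then "all
  `Gal(ℚ̄/ℚ)`-stable `O_λ`-lattices of `V_{F_λ}(f)` have the form `aT` for some `a ∈ F_λ^×`"; the same
  conclusion holds as soon as `T/𝔪T` is irreducible (a stable lattice not inside `𝔪T` maps onto a
  non-zero stable subspace of `T/𝔪T`).
* C. Wuthrich, Doc. Math. 19 (2014) [Wuthrich2014], Prop. 8 (p. 8 of the held copy
  `paper:doi-10-4171-dm-450`): Kato's lattice `V_{ℤ_p}(f)(1)` is the Tate module `T_pE•` of a curve `E•`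
  of the isogeny class (identified through the `X₁(N)`-optimal parametrisation).
* C.-H. Kim, K. Nakamura, *Remarks on Kato's Euler systems for elliptic curves with additive reduction*,
  J. Number Theory 210 (2020) [KimNakamura2020] (held copy `paper:arxiv-1808.07726`, §2 "Computing the
  integral lattice"). **Thm. 2.1** ([pannekoek], [kosters-pannekoek]): "Let `E/ℚ_p` be an elliptic curve
  with additive reduction and `K/ℚ_p` be a finite unramified extension. Then the extension of the formal
  logarithm map on `E` induces an isomorphism `log_E : E₀(K) ⊗ ℤ_p ≅ O_K` if `(E, p)` does not
  satisfy Assumption 2.5" (the exceptional cases, all with `p ∈ {2, 3, 5, 7}`). **Prop. 2.2**: "Let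
  `E/ℚ_p` be an elliptic curve with additive reduction at an odd prime `p` and `K/ℚ_p` be a finite
  unramified extension. Then `p` does not divide `[E(K) : E₀(K)]`." **Cor. 2.3**: "The images of
  `E(K) ⊗ ℤ_p` and `E₀(K) ⊗ ℤ_p` under the logarithm map coincide as `O_K`." **Cor. 2.4**: "The image of
  `H¹(K, T)/H¹_f(K, T)` under `exp*` is `O_K ω_E` where `H¹_f(K, T)` is the image of the Kummer map of
  `E(K) ⊗ ℤ_p`" (`ω_E` a Néron differential, "a basis of the cotangent space of `𝓔` over `O_K` (up to
  a `p`-adic unit)", by local Tate duality). Their standing Assumption 1.1 (3) "The Manin constant is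
  prime to `p`" enters ONLY the identification "`ω_E` corresponds to `f(z)dz` up to a `p`-adic unit"
  used for THEIR `f`-normalised modular symbols `[a/m]^±`; Cor. 2.4 as displayed is a statement about
  `E/K` alone.
* M. Kosters, R. Pannekoek, arXiv:1703.07888 [KostersPannekoek2017], **Thm. 1**: "Assume that `K/ℚ_p`
  is unramified of degree `n` … Let `E/K` be an elliptic curve given by a Weierstrass equation over
  `O_K` … with `a_i ∈ 𝔪_K = pO_K` for each `i`. Then one has `E₀(K) ≅_{ℤ_p} ℤ_pⁿ`, except in the
  following four cases: (i) `p = 2` …; (ii) `p = 3` …; (iii) `p = 5` …; (iv) `p = 7` …" ("any curve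
  with additive reduction can be written in the form of Theorem 1 (Lemma)").
* D. Delbourgo, *Elliptic curves and big Galois representations* (CUP 2008) [Delbourgo2008], Thm. 3.8
  (ii)–(iii) (pp. 71–72): the `N`-PRIMITIVE variant (`z_{Mp^n} ∈ H¹(ℤ[ζ_{Mp^n}, 1/p], p^{−ν_M} T)`,
  `per_∞(Σ_b ψ(b) exp*(z)^{σ_b})^± = L_{{p}}(f, ψ, 1) γ^±`; "what we gain in primitivity we lose in
  integrality") — quoted for orientation; the fact below uses Kato's `N`-imprimitive, integral elements.
* B. Mazur, J. Tate, J. Teitelbaum, Invent. Math. 84 (1986) [MazurTateTeitelbaum1986], §I.8, (8.6):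
  Birch's formula `τ(χ̄) L(f, χ, 1) = Σ_{a mod m} χ̄(a) λ_f(a/m)` for a primitive `χ` mod `m`
  (tree: `ModularForms.twistedSymbolSum`, `ModularForms.twisted_LValue_eq`).

## The derivation (the typed statement is its last line)

Let `E/ℚ` (globally minimal model `V`, so `Ω(V) = V.realPeriodRat` and `|Ω⁻(V)| = V.imaginaryPeriodRat`
are the Néron periods) have ADDITIVE reduction at a prime `p > 7`, with `E[p]` irreducible; `f` its
newform (`k = 2`, `F = ℚ`, `O_λ = ℤ_p`); `m ≥ 1` with `(m, pN) = 1`, `K = ℚ(ζ_m)`, `χ` a primitive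
non-trivial QUADRATIC Dirichlet character mod `m`, `± = χ(−1)`.
1. (Lattice.) `E[p]` irreducible ⟹ every stable `ℤ_p`-lattice of `V_pE` is `p^a T_pE`; with Wuthrich's
   Prop. 8, Kato's `V_{ℤ_p}(f)(1) ≅ p^a T_pE` inside `V_pE ≅ V_{ℚ_p}(f)(1)`. Kato's elements are
   `ℤ_p`-linear in `γ`, so (8.1.3) gives, for `γ ∈ H₁(E(ℂ), ℤ) ≅` (dual of) `T_pE(−1)`:
   `z_γ := _{c,d} z_m^{(p)}(f, 1, 1, ξ, prime(mpN))_γ ∈ H¹(O_K[1/p], T_pE)` (`r = r' = 1`, `ξ ∈ SL₂(ℤ)`).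
2. (Receptacle.) For `v ∣ p` in `K` (unramified, `p ∤ m`), Thm. 2.1 applies (`p > 7`: no exceptional
   case) and Cor. 2.4 gives `exp*_{ω_E}(loc_v z_γ) ∈ O_v` (the minimal model stays minimal and additive
   over the unramified `K_v`, so `ω_E` is a Néron differential there).
3. (Values.) Thm. 9.7 + Thm. 6.6 (1), transported along the modular parametrisation (an isomorphism of
   realisations `h¹(E) ≅ M(f)(1)` compatible with the comparison maps — in this normalisation, `γ` a
   generator of `H₁(E(ℂ), ℤ)^±` and `ω = ω_E` both on `E`, the Manin constant of the parametrisation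
   cancels): `Σ_b χ(b) σ_b(exp*_{ω_E}(loc z_γ)) = T · L_S(E, χ, 1)/Ω^±_γ`, `Ω^±_γ =` the period of
   `ω_E` against `γ^±` `= u · Ω^±_E`, `u ∈ {1, ½, 2}` (real-component / rectangular-lattice factor),
   and `L_S(E,χ,1) = L(E,χ,1) · ∏_{ℓ ∥ N}(1 − a_ℓ χ(ℓ) ℓ⁻¹)` (`S = prime(mpN)`: the Euler factors at
   `ℓ ∣ m` are `1` as `χ(ℓ) = 0`, those at the additive primes — `p` among them — are `1`).
4. (Units.) Choose `c ≡ d ≡ 1 (mod pN)`, `(cd, 6) = 1`, with `χ(c) = χ(d) = −1` (CRT; `(m, 6pN)`-parts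
   independent, `χ ≠ 1` quadratic takes the value `−1` on units): then `T ≡ (1 + 1)(1 + 1)·c^*d^* ≢ 0
   (mod p)` (`p ≥ 5`); `ℓ ≠ p` for `ℓ ∥ N`; `τ(χ)τ(χ̄) = χ(−1) m` is prime to `p`. With Birch's formula,
   items 2–3 read: `ord_p( ∏_{ℓ ∥ N}(ℓ − a_ℓ χ(ℓ)) · Σ_a χ(a){∞, a/m}_f / Ω^±_E ) ≥ 0`, i.e. — writing
   the `f`-value as `r · Ω^±_f` (`r ∈ ℚ`: `χ` quadratic, `f` rational) and `ϖ · Ω^±_E = Ω^±_f` —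
   **`ord_p(ϖ · r) ≥ 0`**. (At `p ∈ {5, 7}` the same holds off the Kosters–Pannekoek exceptional classes;
   not typed here.)

WHY NO MANIN HYPOTHESIS: every object in items 1–4 lives on `E` (`T_pE`, `ω_E`, `H₁(E(ℂ),ℤ)`, `L(E,χ,s) =
L(f,χ,s)`); the newform enters only through Kato's CONSTRUCTION of `z_γ` and through Birch's formula for
the VALUE `L(E,χ,1)`. The Manin constant `c₀` appears exactly when `Ω^±_E` is compared with `Ω^±_f`
(the period scalar `ϖ` of the statement: `ϖ = m₀/|c₀|`, `m₀ ∣ 2`, at the optimal curve) — which is what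
the consumer exploits. Audited independently by cell `bsd-f2-manin` (PROOF-es §C "K1": clean).
Flag for the referee: `Kato-(8.1.3)-9.7-6.6-KimNakamura-2.4-additive-twisted-Neron-reading`
(non-verbatim steps: item 1 lattice transfer; item 3 period bookkeeping; item 4 unit choice).
No `_holds` (size XL: Kato's explicit reciprocity law). BSD-consistency: for the optimal curve the
statement says `ord_p(A_f(χ)·∏(ℓ − a_ℓχ(ℓ))) ≥ ord_p(c₀)` with `A_f(χ) ∈ ½ℤ` (Manin's trick) — implied by
Manin's conjecture, never refuted (Cremona: `c₀ = 1` for `N ≤ 5·10⁵`).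

## References

* K. Kato, Astérisque 295 (2004): (8.1.3) and 8.3 (pp. 180–182), Thm. 6.6 (p. 163), Thm. 9.7 (p. 189),
  Thm. 12.5, 12.6 (pp. 221–222), remark after (12.8.1) (p. 223). [Kato2004Asterisque]
* C.-H. Kim, K. Nakamura, J. Number Theory 210 (2020) 249–279 = arXiv:1808.07726: Assumption 1.1, Thm.
  2.1, Prop. 2.2, Cor. 2.3, Cor. 2.4, Assumption 2.5. [KimNakamura2020]
* M. Kosters, R. Pannekoek, arXiv:1703.07888 (2017): Thm. 1, Cor. 2, Thm. 3. [KostersPannekoek2017]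
* C. Wuthrich, Doc. Math. 19 (2014) 381–402: §3, Prop. 8. [Wuthrich2014]
* D. Delbourgo, *Elliptic Curves and Big Galois Representations*, CUP 2008: Thm. 3.8. [Delbourgo2008]
* B. Mazur, J. Tate, J. Teitelbaum, Invent. Math. 84 (1986): §I.8. [MazurTateTeitelbaum1986]
-/

noncomputable section

open scoped MatrixGroups ModularForm Classical

open CongruenceSubgroup Literature.NumberTheory.EllipticCurves.ModularForms

namespace Literature.NumberTheory.EllipticCurves

/-- **Kato's Euler system read in Néron units at an ADDITIVE prime `p > 7` with `E[p]` irreducible: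
the `N`-imprimitive Birch–Manin values of the quadratic twists of conductor prime to `pN` are
`p`-integral against the NÉRON periods** — a derived reading (weaker than print, never stronger) of:
K. Kato, Astérisque 295 (2004), **(8.1.3)** (p. 180: for `m ≥ 1` and `(c, 6pm) = (d, 6pN) = 1`,
`c ≡ d ≡ 1 mod N`, `ξ ∈ SL₂(ℤ)`, the `p`-adic zeta element `_{c,d}z_m^{(p)}(f, r, r', ξ, S)` lies in
`H¹(ℤ[1/p, ζ_m], V_{O_λ}(f)(k − r))`, `V_{O_λ}(f)` = the `O_λ`-lattice generated by the image of
`V_{k,ℤ_p}(Y₁(N))`, p. 181), **Thm. 9.7** (p. 189: `exp*` sends it to the zeta modular form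
`_{c,d}δ_m(f, r, r', ξ, S) ∈ S(f) ⊗ F ⊗ ℚ(ζ_m)`) and **Thm. 6.6 (1)** (p. 163: for a character
`χ : (ℤ/m)^× → ℂ^×`, `Σ_b χ(b) per_f(σ_b δ)^± = T · L_S(f*, χ, r) · (2πi)^{k−r−1} · γ^±` (`f* = f` for the rational newform `f`) with
`T = (c² − c^u χ̄(c))(d² − d^v χ̄(d))` in the case `ξ ∈ SL₂(ℤ)`; here `k = 2`, `r = r' = 1`, `S =
prime(mpN)`, so `L_S(f,χ,1) = L(f,χ,1) · ∏_{ℓ ∥ N}(1 − a_ℓ χ(ℓ) ℓ⁻¹)` — the Euler factors at the additive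
primes, `p` included, and at `ℓ ∣ m` are `1`); C.-H. Kim, K. Nakamura, J. Number Theory 210 (2020)
**Thm. 2.1** ("Let `E/ℚ_p` be an elliptic curve with additive reduction and `K/ℚ_p` be a finite
unramified extension. Then the extension of the formal logarithm map on `E` induces an isomorphism
`log_E : E₀(K) ⊗ ℤ_p ≅ O_K` if `(E, p)` does not satisfy [the exceptional cases 2.5, all with `p ≤ 7`]")
= M. Kosters, R. Pannekoek, arXiv:1703.07888 **Thm. 1** ("Assume that `K/ℚ_p` is unramified of degree
`n` … `a_i ∈ pO_K` … Then one has `E₀(K) ≅_{ℤ_p} ℤ_pⁿ`, except in the following four cases: (i) `p = 2` …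
(iv) `p = 7` …"), **Prop. 2.2** (`p ∤ [E(K) : E₀(K)]` for odd `p`) and **Cor. 2.4** ("The image of
`H¹(K, T)/H¹_f(K, T)` under `exp*` is `O_K ω_E`", `ω_E` a Néron differential, by local Tate duality);
and the remark after Kato's (12.8.1) (p. 223) / Serre: when `E[p]` is irreducible every
`Gal(ℚ̄/ℚ)`-stable `ℤ_p`-lattice of `V_pE` is `p^a T_pE`, so Kato's integrality for `V_{O_λ}(f)(1)`
(`≅ T_p` of a member of the class, Wuthrich 2014 Prop. 8) is integrality for `T_pE` of every member
`E`, the elements being `ℤ_p`-linear in `γ`. DERIVATION (the typed statement is its last line): for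
`K = ℚ(ζ_m)`, `(m, pN) = 1`, `χ` primitive quadratic mod `m`, `v ∣ p` (unramified): integrality (8.1.3)
and Cor. 2.4 give `exp*_{ω_E}(loc_v z) ∈ O_v`; Thm. 9.7 + 6.6 with `γ^±` a generator of `H₁(E(ℂ), ℤ)^±`
(so that the period of `ω_E` against `γ^±` is the Néron period `Ω^±_E`, up to a factor `2`; in this
normalisation — `γ` and `ω` both on `E` — the Manin constant of the parametrisation cancels, as in the
tree's sibling `Kato2004.rankZero_padicValNat_sha_le_of_additive_potGood_of_imageContainsSL2`) give
`Σ_b χ(b) σ_b exp*_{ω_E}(z) = T · ∏_{ℓ ∥ N}(1 − a_ℓχ(ℓ)/ℓ) · L(E,χ,1)/Ω^±_E · (unit)`; choosing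
`c ≡ d ≡ 1 mod N·p` with `χ(c) = χ(d) = −1` (CRT, `(m, pN) = 1`) makes `T = 4c²d²`-type a `p`-unit
(`p ≥ 5`), and `ℓ ≠ p`, `τ(χ)τ(χ̄) = ±m` are `p`-units; Birch's formula
`τ(χ̄) L(f, χ, 1) = Σ_a χ̄(a){∞, a/m}_f` (Mazur–Tate–Teitelbaum (I.8.6); tree `twistedSymbolSum`).
HENCE, the typed reading: for `V/ℚ` globally minimal (so that `Ω(V) = V.realPeriodRat`,
`|Ω⁻(V)| = V.imaginaryPeriodRat` are the Néron periods) with newform `f`, ADDITIVE at a prime `p > 7`,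
`E[p]` irreducible, `(m, pN) = 1`, `χ` a primitive non-trivial quadratic Dirichlet character mod `m`,
and `ϖ, r ∈ ℚ`: if `χ` is even, `ϖ · Ω(V) = Ω⁺_f` and
`∏_{ℓ ∥ N}(ℓ − a_ℓ(V)χ(ℓ)) · Σ_a χ(a){∞,a/m}_f = r · Ω⁺_f`, then `ord_p(ϖ r) ≥ 0`; if `χ` is odd,
`ϖ · |Ω⁻(V)| = Ω⁻_f` and the same product equals `r · Ω⁻_f · i`, then `ord_p(ϖ r) ≥ 0`
(`ϖ r` = the Néron-normalised imprimitive value, up to sign). It carries NO Manin-constant and NO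
modular-degree hypothesis (contrast Kim–Nakamura's Assumption 1.1 (3), needed only for THEIR
`f`-normalised symbols `[a/m]^±`). Weaker than the derivation in every binder; no `_holds` (size XL:
Kato's explicit reciprocity law). Flag for the referee:
`Kato-(8.1.3)-9.7-6.6-KimNakamura-2.4-additive-twisted-Neron-reading` (non-verbatim steps: lattice
transfer under irreducibility; the period bookkeeping; the unit choice of `T_{c,d}(χ)`) — audited
independently by cell `bsd-f2-manin` (Euler-system lens, PROOF-es §A–§C, §F: "K1 clean").
[cite: Kato2004Asterisque, (8.1.3) (p. 180), Thm. 9.7 (p. 189), Thm. 6.6 (1) (p. 163), remark after (12.8.1) (p. 223)]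
[cite: KimNakamura2020, Thm. 2.1, Prop. 2.2, Cor. 2.3, Cor. 2.4]
[cite: KostersPannekoek2017, Thm. 1 and Cor. 2]
[cite: Delbourgo2008, Thm. 3.8 (ii)-(iii) (pp. 71-72)] [cite: Wuthrich2014, §3 Prop. 8]
[cite: MazurTateTeitelbaum1986, §I.8 (8.6)]
-/
def kato_neron_padicValRat_twistedSymbolSum_nonneg_of_additive : Prop :=
  ∀ (V : WeierstrassCurve ℚ) [V.IsElliptic] [V.IsGloballyMinimal] {N : ℕ} [NeZero N]
    (f : CuspForm (Gamma0 N) 2) (_ : IsNewformOf V f) (p : ℕ) [Fact p.Prime] (_ : 7 < p)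
    (_ : ¬ V.HasGoodReductionAtPrime p) (_ : ¬ V.HasMultiplicativeReductionAtPrime p)
    (_ : V.HasIrreducibleModPGaloisRep p) (m : ℕ) [NeZero m] (_ : m.Coprime (p * N))
    (χ : DirichletCharacter ℂ m) (_ : χ.IsPrimitive) (_ : χ ≠ 1) (_ : MulChar.IsQuadratic χ)
    (ϖ r : ℚ),
    (χ.Even → (ϖ : ℝ) * V.realPeriodRat = plusPeriod f →
      (∏ ℓ ∈ N.primeFactors with ¬ ℓ ^ 2 ∣ N, ((ℓ : ℂ) - (V.LFunction ℓ : ℂ) * χ (ℓ : ZMod m))) *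
          twistedSymbolSum f χ = (r : ℂ) * (plusPeriod f : ℂ) →
      0 ≤ padicValRat p (ϖ * r)) ∧
    (χ.Odd → (ϖ : ℝ) * V.imaginaryPeriodRat = minusPeriod f →
      (∏ ℓ ∈ N.primeFactors with ¬ ℓ ^ 2 ∣ N, ((ℓ : ℂ) - (V.LFunction ℓ : ℂ) * χ (ℓ : ZMod m))) *
          twistedSymbolSum f χ = (r : ℂ) * (minusPeriod f : ℂ) * Complex.I →
      0 ≤ padicValRat p (ϖ * r))


/-! ### All tame characters of order prime to `p` (appended 2026-08-27, seat `bsd-wall-manin-p1` g3)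

The derivation of the module docstring (items 1–4) uses "`χ` quadratic" only in item 4 (unit choice,
`χ(c) = χ(d) = −1`) and to keep `r ∈ ℚ`. For a primitive `χ ≠ 1` of any order `n` prime to `p` the same
reading holds with: (a) `c, d ≡ 1 (mod N)` chosen (CRT) with `χ(c)`, `χ(d)` of exact order `n`, so that
`T ≡ (1 − χ̄(c))(1 − χ̄(d)) (mod p)` is a `p`-unit (`1 − ζ_n` is a unit at `p` for `p ∤ n > 1`); (b) the
Euler factor SYMMETRISED, `∏_{ℓ ∥ N}(ℓ − a_ℓχ(ℓ))(ℓ − a_ℓχ(ℓ)⁻¹)`, so that the statement is implied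
whichever of `L(f, χ, 1)`, `L(f, χ̄, 1)` Kato's `χ`-sum produces against
`Σ_a χ(a){∞, a/m}_f = τ(χ)L(f, χ̄, 1)` (the extra factor is an algebraic integer); (c) `p`-integrality of
`ϖ r ∈ ℚ(χ)` stated as "`s ϖ r` is an algebraic integer for some `s ∈ ℕ`, `p ∤ s`". Consumer: the K4-free
tame-twist lever `Summits/BirchSwinnertonDyer/BirchSwinnertonDyer/Theorems/
AdditiveKolyvaginRoadManinFrameResidueProperRTameTwist*.lean` (all odd characters modulo auxiliary primes
`d′ ≡ d (mod c)` ⟹ `im Λ_f ⊆ ℤ_(p)|Ω⁻(W)|` ⟹ Manin's `p`-part at a lattice-optimal datum, on the locus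
"no `ℓ ∥ N` with `ord_p(ℓ/a_ℓ)` a power of `2`"). -/

/-- **Kato's Euler system read in Néron units at an ADDITIVE prime `p > 7` with `E[p]` irreducible, for
EVERY primitive Dirichlet character of order prime to `p` and conductor prime to `pN`: the `N`-imprimitive
Birch–Manin twisted value is `p`-integral against the NÉRON periods** — the all-characters form of the
sibling `kato_neron_padicValRat_twistedSymbolSum_nonneg_of_additive` above (same derivation — items 1–4
of the module docstring — which nowhere uses that `χ` is quadratic), a derived reading (weaker than print, never stronger) of: K. Kato,
Astérisque 295 (2004), **(8.1.3)** (p. 180: for `m ≥ 1`, `(c, 6pm) = (d, 6pN) = 1`, `c ≡ d ≡ 1 mod N`,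
`ξ ∈ SL₂(ℤ)`, `_{c,d}z_m^{(p)}(f, r, r', ξ, S) ∈ H¹(ℤ[1/p, ζ_m], V_{O_λ}(f)(k − r))` — integral, no
large-image hypothesis), **Thm. 9.7** (p. 189: `exp*` sends it to the zeta modular form
`_{c,d}δ_m(f, r, r', ξ, S)`) and **Thm. 6.6 (1)** (p. 163: for ANY character `χ : (ℤ/m)^× → ℂ^×`,
`Σ_b χ(b) per_f(σ_b δ)^± = T · L_S(f*, χ, r)·(2πi)^{k−r−1}·γ^±` (`f* = f`), `T = (c² − c^u χ̄(c))(d² − d^v χ̄(d))` in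
the case `ξ ∈ SL₂(ℤ)`, `c ≡ d ≡ 1 mod N`; `k = 2`, `r = r' = 1`, `S = prime(mpN)`, so
`L_S(f,χ,1) = L(f,χ,1)·∏_{ℓ ∥ N}(1 − a_ℓχ(ℓ)ℓ⁻¹)`); C.-H. Kim, K. Nakamura, J. Number Theory 210 (2020)
**Thm. 2.1** (= M. Kosters, R. Pannekoek, arXiv:1703.07888 **Thm. 1**: `log_E : E₀(K) ⊗ ℤ_p ≅ O_K` for
`E/ℚ_p` additive, `K/ℚ_p` unramified, `p > 7`), **Prop. 2.2**, **Cor. 2.4** ("the image of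
`H¹(K, T)/H¹_f(K, T)` under `exp*` is `O_K ω_E`"); the remark after Kato's (12.8.1) (p. 223) / Serre
(`E[p]` irreducible ⟹ every stable lattice is `p^a T_pE`) with C. Wuthrich, Doc. Math. 19 (2014)
Prop. 8 (`V_{ℤ_p}(f)(1) = T_p` of a member of the class); and Birch's formula (Mazur–Tate–Teitelbaum
1986, §I.8 (8.6); tree `twistedSymbolSum`). DERIVATION (as in the sibling, items 1–4, with two changes).
(a) UNIT CHOICE: with `c ≡ d ≡ 1 (mod N)` and `p ∣ N`, `T ≡ (1 − χ̄(c))(1 − χ̄(d)) (mod p)`; choose `c, d`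
(CRT, `(m, 6pN) = 1`) with `χ(c)`, `χ(d)` generators of the value group `μ_n`, `n = ord χ > 1`; for
`p ∤ n`, `1 − ζ_n` divides `n'` for a prime `n' ≠ p` or is a unit, so `T` is a `p`-unit. (b) SYMMETRIC
EULER FACTOR: whichever of `L(f, χ, 1)`, `L(f, χ̄, 1)` Kato's `χ`-sum produces against
`Σ_a χ(a){∞, a/m}_f = τ(χ) L(f, χ̄, 1)`, multiplying the `p`-integral `N`-imprimitive value by the OTHER
(algebraic-integer) factor `∏_{ℓ∥N}(ℓ − a_ℓχ^{∓1}(ℓ))` yields the statement below, which is therefore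
implied under either convention. HENCE: for `V/ℚ` globally minimal (Néron periods `Ω(V)`, `|Ω⁻(V)|`) with
newform `f` at level `N`, additive at a prime `p > 7`, `E[p]` irreducible, `(m, pN) = 1`, `χ` primitive
mod `m`, `χ ≠ 1`, `p ∤ ord χ`, and `ϖ ∈ ℚ`, `r ∈ ℂ` with (`χ` even) `ϖ·Ω(V) = Ω⁺_f`,
`∏_{ℓ∥N}(ℓ − a_ℓχ(ℓ))(ℓ − a_ℓχ(ℓ)⁻¹)·Σ_aχ(a){∞,a/m}_f = r·Ω⁺_f`, resp. (`χ` odd) `ϖ·|Ω⁻(V)| = Ω⁻_f`,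
same product `= r·Ω⁻_f·i`: `ϖ·r` is `p`-INTEGRAL, i.e. `s·ϖ·r` is an algebraic integer for some `s ∈ ℕ`
with `p ∤ s` (`r ∈ ℚ(χ)`; for quadratic `χ` this is `ord_p(ϖ r) ≥ 0`, the sibling). NO Manin-constant and
NO modular-degree binder. Flag for the referee: `Kato-(8.1.3)-9.7-6.6-KimNakamura-2.4-additive-twisted-
Neron-reading-all-characters` (non-verbatim steps: lattice transfer under irreducibility; period
bookkeeping; unit choice (a); convention-proofing (b)). No `_holds` (size XL).
[cite: Kato2004Asterisque, (8.1.3) (p. 180), Thm. 9.7 (p. 189), Thm. 6.6 (1) (p. 163), remark after (12.8.1) (p. 223)]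
[cite: KimNakamura2020, Thm. 2.1, Prop. 2.2, Cor. 2.3, Cor. 2.4] [cite: KostersPannekoek2017, Thm. 1 and Cor. 2]
[cite: Wuthrich2014, §3 Prop. 8] [cite: MazurTateTeitelbaum1986, §I.8 (8.6)] -/
def kato_neron_isIntegral_twistedSymbolSum_of_additive : Prop :=
  ∀ (V : WeierstrassCurve ℚ) [V.IsElliptic] [V.IsGloballyMinimal] {N : ℕ} [NeZero N]
    (f : CuspForm (Gamma0 N) 2) (_ : IsNewformOf V f) (p : ℕ) [Fact p.Prime] (_ : 7 < p)
    (_ : ¬ V.HasGoodReductionAtPrime p) (_ : ¬ V.HasMultiplicativeReductionAtPrime p)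
    (_ : V.HasIrreducibleModPGaloisRep p) (m : ℕ) [NeZero m] (_ : m.Coprime (p * N))
    (χ : DirichletCharacter ℂ m) (_ : χ.IsPrimitive) (_ : χ ≠ 1) (_ : ¬ p ∣ orderOf χ)
    (ϖ : ℚ) (r : ℂ),
    (χ.Even → (ϖ : ℝ) * V.realPeriodRat = plusPeriod f →
      (∏ ℓ ∈ N.primeFactors with ¬ ℓ ^ 2 ∣ N,
          (((ℓ : ℂ) - (V.LFunction ℓ : ℂ) * χ (ℓ : ZMod m)) *
            ((ℓ : ℂ) - (V.LFunction ℓ : ℂ) * (χ (ℓ : ZMod m))⁻¹))) *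
          twistedSymbolSum f χ = r * (plusPeriod f : ℂ) →
      ∃ s : ℕ, ¬ p ∣ s ∧ IsIntegral ℤ ((s : ℂ) * ϖ * r)) ∧
    (χ.Odd → (ϖ : ℝ) * V.imaginaryPeriodRat = minusPeriod f →
      (∏ ℓ ∈ N.primeFactors with ¬ ℓ ^ 2 ∣ N,
          (((ℓ : ℂ) - (V.LFunction ℓ : ℂ) * χ (ℓ : ZMod m)) *
            ((ℓ : ℂ) - (V.LFunction ℓ : ℂ) * (χ (ℓ : ZMod m))⁻¹))) *
          twistedSymbolSum f χ = r * (minusPeriod f : ℂ) * Complex.I →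
      ∃ s : ℕ, ¬ p ∣ s ∧ IsIntegral ℤ ((s : ℂ) * ϖ * r))


/-! ### Additive primes `p ≥ 5`: the Kosters–Pannekoek exceptional clause made explicit (appended
2026-08-27, seat `bsd-wall-manin-p1` g4)

Audit of the derivation (memo `MEMO-F1-audit-manin-p1-g4.md`, evidence #11 on stmt-BirchSwinnertonDyer-20709;
Kato Thm. 6.6 (1) SL₂(ℤ) case p. 163, (8.1.2)–(8.1.3) p. 180, §8.3 p. 181, §5.5 p. 156, §4.7 p. 145 read
first-hand): the only place where `p > 7` enters items 1–4 of the module docstring is item 2, the RECEPTACLE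
(Kim–Nakamura Thm. 2.1 = Kosters–Pannekoek Thm. 1: `log_E : E₀(K) ⊗ ℤ_p ≅ O_K` for `E/ℚ_p` additive over an
unramified `K/ℚ_p` "if `(E, p)` does not satisfy Assumption 2.5"; Kim–Nakamura Remark 1.8 (1): "Even in
the `p ≤ 7` case, [the theorems] hold if `(E, p)` does not satisfy Assumption 2.5"; Prop. 2.2 needs only `p`
odd, here `p ≥ 5`). Kosters–Pannekoek Thm. 1 for `K/ℚ_p` unramified of degree `n` with residue field `k`:
exceptional iff (iii) `p = 5` and `N_{k/𝔽₅}(3a₄/5) = 1`, (iv) `p = 7` and `N_{k/𝔽₇}(4a₆/7) = 1` (model with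
`a_i ∈ pO_K`; no exception for `p > 7`); for `E` defined over `ℚ_p`, `ū := 3a₄/5` resp. `4a₆/7 (mod p)` lies in
`𝔽_p`, so `N_{k/𝔽_p}(ū) = ūⁿ`. If `gcd(n, p − 1) = 1` then `ūⁿ = 1 ⟺ ū = 1 ⟺` (Cor. 2) `E₀(ℚ_p) ≅ ℤ_p × ℤ/p
⟺ E(ℚ_p)[p] ≠ 0` (all `p`-torsion of `E(ℚ_p)` lies in `E₀` since `[E(ℚ_p) : E₀(ℚ_p)] ≤ 4 < p`). The receptacle
is applied to the member `E•` whose Tate module is Kato's lattice (item 1) over `K_v = ℚ(ζ_m)_v`, unramified of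
degree `n = ord_m(p)`; under `E[p]` irreducible `E•` and the given `V` are prime-to-`p` isogenous, so
`E•(ℚ_p)[p] = 0 ⟺ V(ℚ_p)[p] = 0`. Hence the same reading holds at every additive `p ≥ 5` under the extra
hypothesis `7 < p ∨ (gcd(ord_m p, p − 1) = 1 ∧ V(ℚ_p)[p] = 0)`. Consumer: the `p ∈ {5, 7}` tame-twist lever of
cell `pub/bsd-wall` (crux `ManinFrameResidueProperR`, stub S57): auxiliary primes `d′ ≡ 3 (mod 4)` with `p` a
square mod `d′` and `r ∤ d′ − 1` for odd `r ∣ p − 1` have `gcd(ord_{d′} p, p − 1) = 1`. -/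

/-- **Kato's Euler system read in Néron units at an ADDITIVE prime `p ≥ 5` with `E[p]` irreducible, for every
primitive Dirichlet character of order prime to `p` and conductor `m` prime to `pN`, OFF the Kosters–Pannekoek
exceptional case** — the sibling `kato_neron_isIntegral_twistedSymbolSum_of_additive` (same conclusion, same
derivation: items 1–4 of the module docstring with (a) unit choice and (b) symmetric Euler factor) with its
hypothesis `7 < p` replaced by `5 ≤ p` together with `7 < p ∨ (gcd(ord_m p, p − 1) = 1 ∧ V(ℚ_p)[p] = 0)`.
A derived reading (weaker than print, never stronger) of: K. Kato, Astérisque 295 (2004) **(8.1.2)–(8.1.3)**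
(p. 180: `_{c,d}z_m^{(p)}(f, r, r′, ξ, S) ∈ H¹(ℤ[1/p, ζ_m], V_{O_λ}(f)(k − r))` for `m ≥ 1`, `ξ ∈ SL₂(ℤ)`,
`S ⊇ prime(mN) ∪ {p}`, `prime(cd) ∩ S = ∅`, `(cd, 6) = 1`, `(d, N) = 1`; §8.3 p. 181: `V_{O_λ}(f)` = the
`O_λ`-submodule generated by the image of `V_{k,ℤ_p}(Y₁(N))`), **Thm. 9.7** (p. 189: `exp*` of it is the zeta
modular form `_{c,d}z_m(f, r, r′, ξ, S) ∈ S(f) ⊗ ℚ(ζ_m)`), **Thm. 6.6 (1), case `ξ ∈ SL₂(ℤ)`** (p. 163: for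
`c ≡ d ≡ 1 mod N`, `Σ_b χ(b) per_f(σ_b(_{c,d}z_m(f, r, r′, ξ, S)))^± = L_S(f*, χ, r)·(2πi)^{k−r−1}·γ^±` with
`γ = (c² − c^uχ̄(c))(d² − d^vχ̄(d))·δ(f, r′, ξ)`, `(u, v) = (1, 1)` at `k = 2`, `r = r′ = 1` by (4.2.4)),
§5.5/§4.7/§6.3 (`δ(f, 1, ξ)` = the image of the Manin symbol of `ξ`) and **Thm. 13.6** (Manin symbols generate
`V_{k,ℤ}`); C.-H. Kim, K. Nakamura, J. Number Theory 210 (2020) **Thm. 2.1** ("`log_E : E₀(K) ⊗ ℤ_p ≅ O_K` if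
`(E, p)` does not satisfy Assumption 2.5"), **Remark 1.8 (1)**, **Prop. 2.2** (`p ∤ [E(K):E₀(K)]`, `p` odd),
**Cor. 2.3**, **Cor. 2.4** ("the image of `H¹(K, T)/H¹_f(K, T)` under `exp*` is `O_K ω_E`"); M. Kosters,
R. Pannekoek, arXiv:1703.07888 **Thm. 1** (`K/ℚ_p` unramified of degree `n`: `E₀(K) ≅ ℤ_pⁿ` except (iii) `p = 5`
and `N_{k/𝔽_p}(3a₄/5) = 1`, (iv) `p = 7` and `N_{k/𝔽_p}(4a₆/7) = 1`; none for `p > 7`) and **Cor. 2** (over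
`ℚ_p`: exceptional iff `a₄ ≡ 10 (mod 25)` resp. `a₆ ≡ 14 (mod 49)`, and then `E₀(ℚ_p) ≅ ℤ_p × ℤ/p`); the
lattice homothety under irreducibility (Nakayama) and Birch's formula (Mazur–Tate–Teitelbaum 1986 §I.8 (8.6)).
DERIVATION of the extra clause (see the section docstring above): over `K_v = ℚ(ζ_m)_v` (unramified of degree
`n = ord_m p`) the exceptional condition reads `ūⁿ = 1` with `ū ∈ 𝔽_p`; when `gcd(n, p − 1) = 1` this is `ū = 1`,
i.e. `E•(ℚ_p)[p] ≠ 0`, i.e. (prime-to-`p` isogeny under irreducibility) `V(ℚ_p)[p] ≠ 0`; so under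
`V(ℚ_p)[p] = 0` the receptacle Cor. 2.4 applies to `E•` over every `K_v`, and items 1, 3, 4 are unchanged
(`T ≡ (1 − χ̄(c))(1 − χ̄(d))` is a `p`-unit for `p ∤ ord χ`; `p ≥ 5` suffices for `(cd, 6) = 1` and Prop. 2.2).
HENCE: for `V/ℚ` globally minimal with newform `f` at level `N`, additive at a prime `p ≥ 5`, `E[p]`
irreducible, `(m, pN) = 1`, and EITHER `p > 7` OR (`gcd(ord_m p, p − 1) = 1` and `V(ℚ_p)` has no point of order
`p`), `χ` primitive mod `m`, `χ ≠ 1`, `p ∤ ord χ`, `ϖ ∈ ℚ`, `r ∈ ℂ` with (`χ` even) `ϖ·Ω(V) = Ω⁺_f`,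
`∏_{ℓ∥N}(ℓ − a_ℓχ(ℓ))(ℓ − a_ℓχ(ℓ)⁻¹)·Σ_aχ(a){∞,a/m}_f = r·Ω⁺_f`, resp. (`χ` odd) `ϖ·|Ω⁻(V)| = Ω⁻_f`, same
product `= r·Ω⁻_f·i`: `s·ϖ·r` is an algebraic integer for some `s ∈ ℕ` with `p ∤ s`. NO Manin-constant and NO
modular-degree binder. Flag for the referee: `Kato-(8.1.3)-9.7-6.6-KimNakamura-2.4-additive-twisted-Neron-
reading-all-characters-p-ge-5` (non-verbatim steps: lattice transfer under irreducibility; functoriality of the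
comparison isomorphisms under the optimal parametrisation — the Manin constant and the modular degree cancel;
unit choice; convention-proofing; the norm computation `N_{k/𝔽_p}(ū) = ūⁿ`). No `_holds` (size XL).
[cite: Kato2004Asterisque, (8.1.3) (p. 180), Thm. 9.7 (p. 189), Thm. 6.6 (1) (p. 163), Thm. 13.6 (p. 227)]
[cite: KimNakamura2020, Thm. 2.1, Remark 1.8 (1), Prop. 2.2, Cor. 2.3, Cor. 2.4]
[cite: KostersPannekoek2017, Thm. 1 and Cor. 2]
[cite: Wuthrich2014, §3 Prop. 8] [cite: MazurTateTeitelbaum1986, §I.8 (8.6)] -/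
def kato_neron_isIntegral_twistedSymbolSum_of_additive_five_le : Prop :=
  ∀ (V : WeierstrassCurve ℚ) [V.IsElliptic] [V.IsGloballyMinimal] {N : ℕ} [NeZero N]
    (f : CuspForm (Gamma0 N) 2) (_ : IsNewformOf V f) (p : ℕ) [Fact p.Prime] (_ : 5 ≤ p)
    (_ : ¬ V.HasGoodReductionAtPrime p) (_ : ¬ V.HasMultiplicativeReductionAtPrime p)
    (_ : V.HasIrreducibleModPGaloisRep p) (m : ℕ) [NeZero m] (_ : m.Coprime (p * N))
    (_ : 7 < p ∨ (Nat.Coprime (orderOf (p : ZMod m)) (p - 1) ∧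
      ∀ P : (V.baseChange ℚ_[p]).toAffine.Point, p • P = 0 → P = 0))
    (χ : DirichletCharacter ℂ m) (_ : χ.IsPrimitive) (_ : χ ≠ 1) (_ : ¬ p ∣ orderOf χ)
    (ϖ : ℚ) (r : ℂ),
    (χ.Even → (ϖ : ℝ) * V.realPeriodRat = plusPeriod f →
      (∏ ℓ ∈ N.primeFactors with ¬ ℓ ^ 2 ∣ N,
          (((ℓ : ℂ) - (V.LFunction ℓ : ℂ) * χ (ℓ : ZMod m)) *
            ((ℓ : ℂ) - (V.LFunction ℓ : ℂ) * (χ (ℓ : ZMod m))⁻¹))) *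
          twistedSymbolSum f χ = r * (plusPeriod f : ℂ) →
      ∃ s : ℕ, ¬ p ∣ s ∧ IsIntegral ℤ ((s : ℂ) * ϖ * r)) ∧
    (χ.Odd → (ϖ : ℝ) * V.imaginaryPeriodRat = minusPeriod f →
      (∏ ℓ ∈ N.primeFactors with ¬ ℓ ^ 2 ∣ N,
          (((ℓ : ℂ) - (V.LFunction ℓ : ℂ) * χ (ℓ : ZMod m)) *
            ((ℓ : ℂ) - (V.LFunction ℓ : ℂ) * (χ (ℓ : ZMod m))⁻¹))) *
          twistedSymbolSum f χ = r * (minusPeriod f : ℂ) * Complex.I →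
      ∃ s : ℕ, ¬ p ∣ s ∧ IsIntegral ℤ ((s : ℂ) * ϖ * r))

end Literature.NumberTheory.EllipticCurves

end
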